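import Summits.QuantumFields.YangMills.Theorems.UnitScaleTiltProp7SymCentreAbelianDict
import Summits.QuantumFields.YangMills.Theorems.UnitScaleTiltProp7NestedMeanParallelLiftDiagGauge
import HarnessLib

/-!
# Route `UnitScaleTilt`, crux K1 child «MinimiserStabilityRegPr» (stmt-QuantumFields-19200), stub `stub_existenceMinimalOrbit` (EX), line «SYM-CENTRE»
# ((R4) assembly, step «plaquette angles are near `2πℤ`») — **WRAP: a small plaquette variable of an abelian `iσ₃`-configuration has its curl within
# `(π∕2)·dist1` of an integer multiple of `2π`** — the six face rows of ✓`LinearLiftFlux.int_cube_of_near_curl` (FLUX-ROUND) from `PlaqSmall`.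

Cell `ym3-torus`, width seat `ym3-torus-px6` (gen 3; (R4) fallback pen).  THEOREMS ONLY (0 `def`, 0 `sorry`).  `--supports stmt-QuantumFields-19200 --as helper`,
count-neutral.  YM₃ on T³ is a ladder rung (R3), not the Clay problem; nothing here claims the stub, the crux, d = 4 or the mass gap.

* §1 (real analysis) ★`exists_int_abs_sub_two_pi_mul_le (c) : ∃ m : ℤ, |c − 2πm| ≤ π ∧ 2∕π·|c − 2πm| ≤ 2|sin(c∕2)|` (nearest multiple `m := round(c∕2π)`,
  `sin(c∕2) = ±sin((c − 2πm)∕2)`, Jordan `2x∕π ≤ sin x` on `[0, π∕2]`), `abs_sub_two_pi_mul_le_of_sin_le`.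
* §2 (matrices) `norm_cexp_sub_one_le_norm_exp_sigma3_sub_one` (`|e^{ic} − 1| ≤ ‖exp(c·iσ₃) − 1‖`, Mathlib `Matrix.l2_opNorm_diagonal`),
  ★★`exists_int_abs_sub_two_pi_mul_le_of_norm_exp_sigma3 (h : ‖exp(c·iσ₃) − 1‖ ≤ ε) : ∃ m : ℤ, |c − 2πm| ≤ (π∕2)·ε`.
* §3 (fields) ★★★`exists_int_near_curl_of_plaqSmall` — for `θ : PBond P j → ℝ` with `PlaqSmall δ (gexpAt (suGroupModel 2) I_smul_sigma3_mem_lie θ)`: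
  `∃ m : Site P j → Fin d → Fin d → ℤ, ∀ x μ ν, μ ≠ ν → |curlAt θ x μ ν − 2π·m x μ ν| ≤ (π∕2)·δ` (and `m x μ μ = 0`).
HONEST SCOPE.  Elementary; no stub ∕ crux statement is advanced.

References: T. Bałaban, CMP 98 (1985) 17–51 [Balaban1985Averaging] ((9) p.19, (19)+(24) p.21).
-/

set_option autoImplicit false

noncomputable section

open scoped BigOperators Matrix.Norms.L2Operator Matrix

namespace Summit.QuantumFields.YangMills.Theorems.Prop7NestedMeanParallelLiftDiagGauge

open Literature.MathematicalPhysics.QuantumFieldTheory.Balaban1983to89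
open T4Continuum
open B9AdOrthogonal (σ₃)
open Summit.QuantumFields.YangMills.Theorems.AbelianEML (gexpAt curlAt coe_gexp_su)
open Summit.QuantumFields.Balaban3D.Carriers (suGroupModel)
open Summit.QuantumFields.YangMills.Theorems.BalabanUVNodesN08AlphaAbelianLift (gexp)
open Summit.QuantumFields.YangMills.Theorems.Prop7SymCentreAbelianDict (I_smul_sigma3_mem_lie plaqHol_gexpAt_curlAt)

/-! ## §1 Nearest multiple of `2π` -/

/-- ★ **NEAREST MULTIPLE OF `2π`**: for every real `c` there is an integer `m` with `|c − 2πm| ≤ π` and Jordan's bound `(2∕π)|c − 2πm| ≤ 2|sin(c∕2)|`. [folklore] -/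
theorem exists_int_abs_sub_two_pi_mul_le (c : ℝ) :
    ∃ m : ℤ, |c - 2 * Real.pi * m| ≤ Real.pi ∧ 2 / Real.pi * |c - 2 * Real.pi * m| ≤ 2 * |Real.sin (c / 2)| := by
  have hπ := Real.pi_pos
  refine ⟨round (c / (2 * Real.pi)), ?_, ?_⟩
  · have h := abs_sub_round (c / (2 * Real.pi))
    have key : c - 2 * Real.pi * (round (c / (2 * Real.pi)) : ℝ) = (2 * Real.pi) * (c / (2 * Real.pi) - round (c / (2 * Real.pi))) := by
      field_simp
    have h2 : |c - 2 * Real.pi * (round (c / (2 * Real.pi)) : ℝ)| = 2 * Real.pi * |c / (2 * Real.pi) - round (c / (2 * Real.pi))| := by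
      rw [key, abs_mul, abs_of_pos (by positivity : (0 : ℝ) < 2 * Real.pi)]
    rw [h2]
    nlinarith
  · set x : ℝ := c - 2 * Real.pi * (round (c / (2 * Real.pi)) : ℝ) with hx
    have hxπ : |x| ≤ Real.pi := by
      have h := abs_sub_round (c / (2 * Real.pi))
      have key : x = (2 * Real.pi) * (c / (2 * Real.pi) - round (c / (2 * Real.pi))) := by
        rw [hx]; field_simp
      have h2 : |x| = 2 * Real.pi * |c / (2 * Real.pi) - round (c / (2 * Real.pi))| := by
        rw [key, abs_mul, abs_of_pos (by positivity : (0 : ℝ) < 2 * Real.pi)]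
      rw [h2]; nlinarith
    -- `sin(c/2) = (−1)^m sin(x/2)`
    have hsin : |Real.sin (c / 2)| = |Real.sin (x / 2)| := by
      have hc : c / 2 = x / 2 + (round (c / (2 * Real.pi)) : ℤ) * Real.pi := by rw [hx]; ring
      rw [hc, Real.sin_add_int_mul_pi, abs_mul, abs_zpow, abs_neg, abs_one, one_zpow, one_mul]
    rw [hsin]
    -- Jordan on `|x/2| ≤ π/2`
    have hx2 : |x / 2| ≤ Real.pi / 2 := by rw [abs_div, abs_two]; linarith
    have hj : 2 / Real.pi * |x / 2| ≤ |Real.sin (x / 2)| := by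
      rcases le_or_gt 0 (x / 2) with h0 | h0
      · rw [abs_of_nonneg h0] at hx2 ⊢
        exact (Real.mul_le_sin h0 hx2).trans (le_abs_self _)
      · have h0' : 0 ≤ -(x / 2) := by linarith
        rw [abs_of_neg h0] at hx2 ⊢
        have h1 := Real.mul_le_sin h0' hx2
        rw [Real.sin_neg] at h1
        exact h1.trans (neg_le_abs _)
    have : 2 / Real.pi * |x| = 2 * (2 / Real.pi * |x / 2|) := by rw [abs_div, abs_two]; ring
    rw [this]
    linarith

/-- Hence, if `2|sin(c∕2)| ≤ ε`, the nearest multiple is within `(π∕2)·ε`. [folklore] -/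
theorem exists_int_abs_sub_two_pi_mul_le_of_sin_le {c ε : ℝ} (h : 2 * |Real.sin (c / 2)| ≤ ε) :
    ∃ m : ℤ, |c - 2 * Real.pi * m| ≤ Real.pi / 2 * ε := by
  obtain ⟨m, -, hj⟩ := exists_int_abs_sub_two_pi_mul_le c
  have hπ := Real.pi_pos
  refine ⟨m, ?_⟩
  have h1 : 2 / Real.pi * |c - 2 * Real.pi * m| ≤ ε := hj.trans h
  have h2 := mul_le_mul_of_nonneg_left h1 (by positivity : (0 : ℝ) ≤ Real.pi / 2)
  calc |c - 2 * Real.pi * m| = Real.pi / 2 * (2 / Real.pi * |c - 2 * Real.pi * m|) := by field_simp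
    _ ≤ Real.pi / 2 * ε := h2

/-! ## §2 The matrix reading: `‖exp(c·iσ₃) − 1‖` controls `|e^{ic} − 1| = 2|sin(c∕2)|` -/

/-- `exp(c·iσ₃) − 1 = diag(e^{ic} − 1, e^{−ic} − 1)`. [folklore] -/
theorem exp_sigma3_sub_one_eq_diagonal (c : ℝ) :
    NormedSpace.exp ((c : ℂ) • (Complex.I • σ₃) : Matrix (Fin 2) (Fin 2) ℂ) - 1 =
      Matrix.diagonal ![Complex.exp ((c : ℂ) * Complex.I) - 1, Complex.exp (-((c : ℂ) * Complex.I)) - 1] := by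
  have hd : ((c : ℂ) • (Complex.I • σ₃) : Matrix (Fin 2) (Fin 2) ℂ) = Matrix.diagonal ![(c : ℂ) * Complex.I, -((c : ℂ) * Complex.I)] := by
    rw [sigma3_eq]; ext i j; fin_cases i <;> fin_cases j <;> simp [Matrix.diagonal]
  rw [hd, Matrix.exp_diagonal, Pi.exp_def]
  ext i j
  fin_cases i <;> fin_cases j <;> simp [Matrix.diagonal, congrFun Complex.exp_eq_exp_ℂ]

/-- `|e^{ic} − 1| ≤ ‖exp(c·iσ₃) − 1‖` (a diagonal entry is bounded by the operator norm, Mathlib `Matrix.l2_opNorm_diagonal`). [folklore] -/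
theorem norm_cexp_sub_one_le_norm_exp_sigma3_sub_one (c : ℝ) :
    ‖Complex.exp ((c : ℂ) * Complex.I) - 1‖ ≤ ‖NormedSpace.exp ((c : ℂ) • (Complex.I • σ₃) : Matrix (Fin 2) (Fin 2) ℂ) - 1‖ := by
  rw [exp_sigma3_sub_one_eq_diagonal, Matrix.l2_opNorm_diagonal]
  exact norm_le_pi_norm (![Complex.exp ((c : ℂ) * Complex.I) - 1, Complex.exp (-((c : ℂ) * Complex.I)) - 1]) 0

/-- ★★ **WRAP**: `‖exp(c·iσ₃) − 1‖ ≤ ε ⇒ ∃ m ∈ ℤ, |c − 2πm| ≤ (π∕2)·ε`. [folklore] -/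
theorem exists_int_abs_sub_two_pi_mul_le_of_norm_exp_sigma3 {c ε : ℝ}
    (h : ‖NormedSpace.exp ((c : ℂ) • (Complex.I • σ₃) : Matrix (Fin 2) (Fin 2) ℂ) - 1‖ ≤ ε) :
    ∃ m : ℤ, |c - 2 * Real.pi * m| ≤ Real.pi / 2 * ε := by
  apply exists_int_abs_sub_two_pi_mul_le_of_sin_le
  have h1 := (norm_cexp_sub_one_le_norm_exp_sigma3_sub_one c).trans h
  have h2 : ‖Complex.exp ((c : ℂ) * Complex.I) - 1‖ = 2 * |Real.sin (c / 2)| := by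
    rw [mul_comm, Complex.norm_exp_I_mul_ofReal_sub_one, Real.norm_eq_abs, abs_mul, abs_two]
  linarith [h2.symm.le.trans h1]

/-! ## §3 The field reading: near-integer curls from `PlaqSmall` -/

/-- ★★★ **NEAR-INTEGER CURLS OF A SMALL-PLAQUETTE ABELIAN `iσ₃`-CONFIGURATION**: if `PlaqSmall δ (gexpAt … θ)` then every plaquette angle `curlAt θ` is within
`(π∕2)·δ` of `2π·m` for an integer function `m` of the plaquettes (zero on the degenerate `μ = ν`) — the face rows of ✓`int_cube_of_near_curl`.
[cite: Balaban1985Averaging, (9) p.19, (19)+(24) p.21] -/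
theorem exists_int_near_curl_of_plaqSmall {P : Params} {j : ℕ} (θ : PBond P j → ℝ) {δ : ℝ}
    (hV : PlaqSmall δ (gexpAt (suGroupModel 2) I_smul_sigma3_mem_lie θ)) :
    ∃ m : Site P j → Fin P.d → Fin P.d → ℤ, (∀ x μ, m x μ μ = 0) ∧
      ∀ (x : Site P j) (μ ν : Fin P.d), μ ≠ ν → |curlAt θ x μ ν - 2 * Real.pi * m x μ ν| ≤ Real.pi / 2 * δ := by
  classical
  -- pointwise for `μ < ν`: the plaquette variable is `gexp (curl θ)`, `dist1 = ‖exp − 1‖`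
  have hlt : ∀ (x : Site P j) (μ ν : Fin P.d), μ < ν → ∃ m : ℤ, |curlAt θ x μ ν - 2 * Real.pi * m| ≤ Real.pi / 2 * δ := by
    intro x μ ν hμν
    have h1 := hV ⟨x, μ, ν, hμν⟩
    rw [plaqHol_gexpAt_curlAt I_smul_sigma3_mem_lie] at h1
    have h2 : ‖NormedSpace.exp (((curlAt θ x μ ν : ℝ) : ℂ) • (Complex.I • σ₃) : Matrix (Fin 2) (Fin 2) ℂ) - 1‖ < δ := by
      rw [← coe_gexp_su I_smul_sigma3_mem_lie]
      exact h1
    exact exists_int_abs_sub_two_pi_mul_le_of_norm_exp_sigma3 h2.le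
  -- `μ > ν` by antisymmetry of the curl
  have hpt : ∀ (x : Site P j) (μ ν : Fin P.d), μ ≠ ν → ∃ m : ℤ, |curlAt θ x μ ν - 2 * Real.pi * m| ≤ Real.pi / 2 * δ := by
    intro x μ ν hμν
    rcases lt_or_gt_of_ne hμν with h | h
    · exact hlt x μ ν h
    · obtain ⟨m, hm⟩ := hlt x ν μ h
      refine ⟨-m, ?_⟩
      have hswap : curlAt θ x μ ν = -curlAt θ x ν μ := by simp only [curlAt]; ring
      rw [hswap, Int.cast_neg, show -curlAt θ x ν μ - 2 * Real.pi * -(m : ℝ) = -(curlAt θ x ν μ - 2 * Real.pi * m) by ring, abs_neg]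
      exact hm
  choose m hm using hpt
  refine ⟨fun x μ ν => if hμν : μ ≠ ν then m x μ ν hμν else 0, fun x μ => by simp, fun x μ ν hμν => ?_⟩
  simp only [hμν, ne_eq, not_false_eq_true, dif_pos]
  exact hm x μ ν hμν

end Summit.QuantumFields.YangMills.Theorems.Prop7NestedMeanParallelLiftDiagGauge

end
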